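import Literature.AnabelianGeometry.EtaleTheta.Discharge.Sec3Thm37Units
import Literature.AnabelianGeometry.EtaleTheta.Discharge.Sec3Thm37SlimOfUnits
import HarnessLib

/-!
# [EtTh] Theorem 3.7 (i) «unit-trivial / unit-profinite type» and (iv) «`D` slim ⟹ `C` slim» —
# the chain of `Sec3Thm37Units.lean` WITHOUT "`C` is a Frobenioid"; UNCONDITIONAL at the canonical
# vocabulary (no residual `hBmon`), in particular for the constructed `Λ = ℝ` data `ofRlfR`

S. Mochizuki, *The étale theta function and its Frobenioid-theoretic manifestations*, Publ. RIMS **45**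
(2009), Theorem 3.7 (i), (iv), PDF pp. 79–80 [cite: MochizukiEtTh2009, Thm 3.7 p.79]
[cite: MochizukiEtTh2009, Thm 3.7 p.80]: "(i) If `Λ = ℤ` (respectively, `Λ = ℝ`), then `C` is of
unit-profinite (respectively, unit-trivial) type … (iv) If `D` is slim, and `Λ ∈ {ℤ, ℝ}`, then `C` is also
slim", printed proof "(iv) follows formally from [FrdI], Proposition 1.13, (iii) [since, by (i), condition
(b) of loc. cit. is always satisfied]".

PROOF-ONLY companion (abc-iut cell, F fact-proving wave FLOAT, seat abc-iut-f-047; FACT-LIST rows F-0743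
`Thm37_i`, F-0744 `Thm37_iv`, unseated tranche 137). Seat abc-iut-L6-t13's `Sec3Thm37Units.lean` derives
the input `hdiv : ⋂ₙ O^×(A)ⁿ = 1` of (iv) from the structure of the data — `Λ = ℝ`: `B₀^Λ → (Φ₀^ℝ)^gp`
injective ⇒ unit-trivial; `Λ = ℤ`: kernels `Ker(B₀^Λ(Y)^× → (Φ₀^ℝ)^gp(Y))` tfg profinite ⇒ unit-profinite —
but every theorem there carries `hF : IsFrobenioid C₀.toElem` ("`C → F_Φ` is a Frobenioid", [FrdI] Thm.
5.2 (ii)), at the canonical vocabulary the residual datum `hBmon : IsMonoidOn B`. Inspection of those proofs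
shows `hF` is used ONLY to know that the divisor monoids `Φ(A_D)` are divisorial (sharp and integral); and
the (iv)-step no longer needs `hF` either (`thm37_iv_of_sharp`, seat abc-iut-f-047, via [FrdI] Prop. 1.13
(iii)(b) for model categories without the Frobenioid axioms). THIS FILE re-runs the chain under
`hΦ : ∀ A, IsDivisorial (Φ(A))` (resp. sharpness) in place of `hF`:
* `thm37_i_unitTrivial_of_isDivisorial` — (i) "unit-trivial type" from `hΦ` + injectivity of
  `B₀^Λ → (Φ₀^ℝ)^gp`; `thm37_iv_of_isDivisorial_of_divΛ_injective`; `thm37_iv_of_sharp_of_isOfUnitProfiniteType`;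
  `nonempty_units_mulEquiv_ker_of_isDivisorial` (`O^×(A) ≅ Ker(B₀^Λ(Y_A)^× → (Φ₀^ℝ)^gp(Y_A))`),
  `isOfUnitProfiniteType_of_isDivisorial_of_ker`, `thm37_iv_of_isDivisorial_of_ker`;
* at the canonical [FrdI] vocabulary `treeCatVocab` (field `isDivisorialOn` = `Φ` a divisorial monoid on
  `D`) ALL of these hold with NO residual hypothesis beyond the data-shape inputs (`hinj` / `hker` /
  unit-profinite type): `…_treeCatVocab_…`;
* for the CONSTRUCTED data of monoid type `ℝ` (`RealifiedDivisorMonoids.ofRlfR`, abc-iut-L6-t12) over the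
  canonical vocabulary: **`thm37_i_unitTrivial_ofRlfR_treeCatVocab_holds` and
  `thm37_iv_ofRlfR_treeCatVocab_holds` — Thm. 3.7 (i) "unit-trivial type" and Thm. 3.7 (iv), UNCONDITIONAL**
  (supersede `…_ofRlfR_treeCatVocab (hBmon)`).
No definition; nothing here bears on [IUTchIII] Cor. 3.12; typed ≠ proved elsewhere.
-/

namespace Literature.AnabelianGeometry.EtaleTheta

open CategoryTheory Opposite Literature.AlgebraicGeometry.Frobenioids

universe u₀ v₀ u v w

variable {D₀ : Type u₀} [Category.{v₀} D₀] {V : FrdIMonoidStub.{w}}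
  {T : RealifiedDivisorMonoids (D₀ := D₀) V} {D : Type u} [Category.{v} D]

namespace TemperedFrobenioid

section General

variable {VD : FrdICatStub.{u, v, w} D} (C₀ : TemperedFrobenioid T D VD)

/-- **(L05) without `hF`**: for sharp divisor monoids, the `B₀^Λ`-component of the rational function
`u_σ ∈ B(A_D) = B₀^Λ(Y_A) ×_{(Φ^{ℝ-log})^gp} Φ(A_D)^gp` of a unit `σ ∈ O^×(A)` lies in the kernel of
`B₀^Λ(Y_A) → (Φ₀^ℝ)^gp(Y_A)` (`Div(σ) = 0`, so `Div_B(u_σ) = 0`, and the fibre-product condition).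
[cite: MochizukiEtTh2009, Thm 3.7 p.79] -/
theorem fst_unitsToRatFn_mem_ker_of_isSharp (hΦ : ∀ A : D, IsSharp (C₀.divisorMonoid.obj (op A)))
    (X : C₀.category) (a : ModelFrobenioid.units X) :
    T.divΛ (C₀.baseOp (op X.base))
      ((ModelFrobenioid.unitsToRatFn X a : C₀.ratFnFunctor.obj (op X.base)) :
        C₀.ratFn (op X.base)).1.1 = 1 := by
  set p : C₀.ratFn (op X.base) :=
    (ModelFrobenioid.unitsToRatFn X a : C₀.ratFnFunctor.obj (op X.base)) with hp
  have h1 : Literature.AlgebraicGeometry.Frobenioids.divB C₀.divisorMonoid C₀.ratFnFunctor C₀.divBNatTrans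
      (op X.base) (ModelFrobenioid.unitsToRatFn X a : C₀.ratFnFunctor.obj (op X.base)) = 1 :=
    ModelFrobenioid.divB_unitsToRatFn_eq_one (hΦ X.base) a
  have h2 : p.1.2 = 1 := h1
  rw [p.2, h2, map_one]

/-- **(L07) Thm. 3.7 (i), "`C` is of unit-trivial type" (the case `Λ = ℝ`), without `hF`**: if the divisor
monoids `Φ(A_D)` are divisorial and `B₀^Λ(Y) → (Φ₀^ℝ)^gp(Y)` is injective (Def. 3.6 (i): `B₀^ℝ :=
ℝ·Φ₀^birat ⊆ (Φ₀^ℝ)^gp`), every `O^×(A)` is trivial — print's route "by the definition of the realification".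
[cite: MochizukiEtTh2009, Thm 3.7 p.79] -/
theorem thm37_i_unitTrivial_of_isDivisorial
    (hΦ : ∀ A : D, IsDivisorial (C₀.divisorMonoid.obj (op A)))
    (hinj : ∀ A : Dᵒᵖ, Function.Injective (T.divΛ (C₀.baseOp A))) :
    PreFrobenioid.IsOfType (PreFrobenioid.IsUnitTrivial C₀.toElem) := by
  intro X α hα
  have hΦX : IsDivisorial (C₀.divisorMonoid.obj (op X.base)) := hΦ X.base
  let a : ModelFrobenioid.units X := ⟨α, hα⟩
  set p : C₀.ratFn (op X.base) :=
    (ModelFrobenioid.unitsToRatFn X a : C₀.ratFnFunctor.obj (op X.base)) with hp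
  have h1 : Literature.AlgebraicGeometry.Frobenioids.divB C₀.divisorMonoid C₀.ratFnFunctor C₀.divBNatTrans
      (op X.base) (ModelFrobenioid.unitsToRatFn X a : C₀.ratFnFunctor.obj (op X.base)) = 1 :=
    ModelFrobenioid.divB_unitsToRatFn_eq_one hΦX.isSharp a
  have h2 : p.1.2 = 1 := h1
  have h3 : p.1.1 = 1 := by
    apply hinj (op X.base)
    rw [map_one, p.2, h2, map_one]
  have h4 : p = 1 := Subtype.ext (Prod.ext h3 h2)
  have h5 : ModelFrobenioid.unitsToRatFn X a = 1 := Units.val_eq_one.mp h4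
  have h6 : a = 1 :=
    ModelFrobenioid.unitsToRatFn_injective hΦX.isPreDivisorial.isIntegral (by rw [h5, map_one])
  exact congrArg Subtype.val h6

/-- Under the same hypotheses every `O^×(A)` is the trivial subgroup. [cite: MochizukiEtTh2009, Thm 3.7 p.79] -/
theorem unitsSubgroup_eq_bot_of_isDivisorial
    (hΦ : ∀ A : D, IsDivisorial (C₀.divisorMonoid.obj (op A)))
    (hinj : ∀ A : Dᵒᵖ, Function.Injective (T.divΛ (C₀.baseOp A))) (X : C₀.category) :
    PreFrobenioid.unitsSubgroup C₀.toElem X = ⊥ :=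
  (Subgroup.eq_bot_iff_forall _).2 (C₀.thm37_i_unitTrivial_of_isDivisorial hΦ hinj X)

/-- **(L13, Λ = ℝ) + (L00) Thm. 3.7 (iv) without `hF`**: "`D` slim ⟹ `C` slim" (the named `Prop`
`Thm37_iv`) for divisorial `Φ(A_D)` and injective `B₀^Λ → (Φ₀^ℝ)^gp` — `hdiv` from unit-triviality, the
(iv)-step by `thm37_iv_of_sharp`. [cite: MochizukiEtTh2009, Thm 3.7 p.80] -/
theorem thm37_iv_of_isDivisorial_of_divΛ_injective
    (hΦ : ∀ A : D, IsDivisorial (C₀.divisorMonoid.obj (op A)))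
    (hinj : ∀ A : Dᵒᵖ, Function.Injective (T.divΛ (C₀.baseOp A))) : C₀.Thm37_iv :=
  C₀.thm37_iv_of_sharp (fun A => (hΦ A).isSharp)
    (PreFrobenioid.hdiv_of_isUnitTrivial C₀.toElem (C₀.thm37_i_unitTrivial_of_isDivisorial hΦ hinj))

/-- **(L13, Λ = ℤ) + (L00Z) Thm. 3.7 (iv) without `hF`**: for sharp divisor monoids, "unit-profinite type"
([FrdI] Def. 2.8 (i), the `Λ = ℤ` clause of Thm. 3.7 (i)) gives `hdiv` (a profinite group has no
non-trivial divisible element), hence `Thm37_iv`. [cite: MochizukiEtTh2009, Thm 3.7 p.80] -/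
theorem thm37_iv_of_sharp_of_isOfUnitProfiniteType
    (hΦ : ∀ A : D, IsSharp (C₀.divisorMonoid.obj (op A)))
    (hprof : PreFrobenioid.IsOfUnitProfiniteType C₀.toElem) : C₀.Thm37_iv :=
  C₀.thm37_iv_of_sharp hΦ (PreFrobenioid.hdiv_of_isOfUnitProfiniteType C₀.toElem hprof)

/-- **(L05/L06) `O^×(A) ≅ Ker(B₀^Λ(Y_A)^× → (Φ₀^ℝ)^gp(Y_A))` without `hF`** (divisorial `Φ(A_D)`): the
group isomorphism `σ ↦ (B₀^Λ`-component of `u_σ)` — injective by `unitsToRatFn_injective` (`Φ(A_D)`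
integral), onto the kernel by `unitAut` applied to `(b, 0) ∈ B(A_D)`.
[cite: MochizukiEtTh2009, Thm 3.7 p.79] -/
theorem nonempty_units_mulEquiv_ker_of_isDivisorial
    (hΦ' : ∀ A : D, IsDivisorial (C₀.divisorMonoid.obj (op A))) (X : C₀.category) :
    Nonempty (ModelFrobenioid.units X ≃*
      ((T.divΛ (C₀.baseOp (op X.base))).comp
        (Units.coeHom (T.BΛ.obj (C₀.baseOp (op X.base))))).ker) := by
  have hΦ : IsDivisorial (C₀.divisorMonoid.obj (op X.base)) := hΦ' X.base
  -- the projection `B(A_D) → B₀^Λ(Y_A)` and the candidate map `σ ↦ (B₀^Λ-component of u_σ)`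
  let φ : C₀.ratFnFunctor.obj (op X.base) →* T.BΛ.obj (C₀.baseOp (op X.base)) :=
    (MonoidHom.fst _ _).comp (C₀.ratFn (op X.base)).subtype
  have hφ : ∀ q : C₀.ratFnFunctor.obj (op X.base), φ q = (q : C₀.ratFn (op X.base)).1.1 := fun _ => rfl
  -- the `Φ^gp`-component of `u_σ` is trivial, its `B₀^Λ`-component is in the kernel
  have hsnd : ∀ a : ModelFrobenioid.units X,
      ((ModelFrobenioid.unitsToRatFn X a : C₀.ratFnFunctor.obj (op X.base)) :
        C₀.ratFn (op X.base)).1.2 = 1 := fun a =>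
    (ModelFrobenioid.divB_unitsToRatFn_eq_one hΦ.isSharp a :)
  have hmem : ∀ a : ModelFrobenioid.units X,
      ((Units.map φ).comp (ModelFrobenioid.unitsToRatFn X)) a ∈
        ((T.divΛ (C₀.baseOp (op X.base))).comp
          (Units.coeHom (T.BΛ.obj (C₀.baseOp (op X.base))))).ker := fun a => by
    rw [MonoidHom.mem_ker, MonoidHom.comp_apply, MonoidHom.comp_apply, Units.coeHom_apply,
      Units.coe_map, hφ]
    exact C₀.fst_unitsToRatFn_mem_ker_of_isSharp (fun A => (hΦ' A).isSharp) X a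
  let θ := ((Units.map φ).comp (ModelFrobenioid.unitsToRatFn X)).codRestrict _ hmem
  have hθ : ∀ a, ((θ a : ((T.divΛ (C₀.baseOp (op X.base))).comp
      (Units.coeHom (T.BΛ.obj (C₀.baseOp (op X.base))))).ker) :
        (T.BΛ.obj (C₀.baseOp (op X.base)))ˣ) = Units.map φ (ModelFrobenioid.unitsToRatFn X a) :=
    fun _ => rfl
  refine ⟨MulEquiv.ofBijective θ ⟨fun a b hab => ?_, fun b => ?_⟩⟩
  · -- injective
    have h0 : φ (ModelFrobenioid.unitsToRatFn X a : C₀.ratFnFunctor.obj (op X.base)) =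
        φ (ModelFrobenioid.unitsToRatFn X b : C₀.ratFnFunctor.obj (op X.base)) := by
      rw [← Units.coe_map, ← Units.coe_map, ← hθ, ← hθ, hab]
    have h1 : ((ModelFrobenioid.unitsToRatFn X a : C₀.ratFnFunctor.obj (op X.base)) :
        C₀.ratFn (op X.base)) =
        ((ModelFrobenioid.unitsToRatFn X b : C₀.ratFnFunctor.obj (op X.base)) : C₀.ratFn (op X.base)) :=
      Subtype.ext (Prod.ext (by rw [← hφ, ← hφ]; exact h0) (by rw [hsnd, hsnd]))
    exact ModelFrobenioid.unitsToRatFn_injective hΦ.isPreDivisorial.isIntegral (Units.ext h1)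
  · -- surjective: `(b, 0) ∈ B(A_D)` for `b` in the kernel gives a unit of `A`
    obtain ⟨bu, hb⟩ := b
    rw [MonoidHom.mem_ker, MonoidHom.comp_apply, Units.coeHom_apply] at hb
    have hb' : T.divΛ (C₀.baseOp (op X.base)) (↑bu⁻¹ : T.BΛ.obj (C₀.baseOp (op X.base))) = 1 := by
      have h := map_mul (T.divΛ (C₀.baseOp (op X.base)))
        (↑bu⁻¹ : T.BΛ.obj (C₀.baseOp (op X.base))) (↑bu : T.BΛ.obj (C₀.baseOp (op X.base)))
      rw [Units.inv_mul, map_one, hb, mul_one] at h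
      exact h.symm
    let p : C₀.ratFn (op X.base) := ⟨((bu : T.BΛ.obj (C₀.baseOp (op X.base))), 1), by
      change T.divΛ (C₀.baseOp (op X.base)) bu = C₀.ΦgpToRlog (op X.base) 1
      rw [map_one, hb]⟩
    let p' : C₀.ratFn (op X.base) := ⟨((↑bu⁻¹ : T.BΛ.obj (C₀.baseOp (op X.base))), 1), by
      change T.divΛ (C₀.baseOp (op X.base)) ↑bu⁻¹ = C₀.ΦgpToRlog (op X.base) 1
      rw [map_one, hb']⟩
    have h : Algebra.GrothendieckGroup.of (1 : C₀.divisorMonoid.obj (op X.base)) =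
        Literature.AlgebraicGeometry.Frobenioids.divB C₀.divisorMonoid C₀.ratFnFunctor C₀.divBNatTrans
          (op X.base) (p : C₀.ratFnFunctor.obj (op X.base)) := by
      rw [map_one]; rfl
    have h' : Algebra.GrothendieckGroup.of (1 : C₀.divisorMonoid.obj (op X.base)) =
        Literature.AlgebraicGeometry.Frobenioids.divB C₀.divisorMonoid C₀.ratFnFunctor C₀.divBNatTrans
          (op X.base) (p' : C₀.ratFnFunctor.obj (op X.base)) := by
      rw [map_one]; rfl
    have hu : (p' : C₀.ratFnFunctor.obj (op X.base)) * p = 1 :=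
      Subtype.ext (Prod.ext (Units.inv_mul bu) (one_mul 1))
    let α : Aut X := ModelFrobenioid.unitAut X 1 1 (p : C₀.ratFnFunctor.obj (op X.base)) p' h h'
      (one_mul 1) hu
    refine ⟨⟨α, ModelFrobenioid.unitAut_mem_units X 1 1 _ _ h h' (one_mul 1) hu⟩,
      Subtype.ext (Units.ext ?_)⟩
    rw [hθ, Units.coe_map, hφ]
    rfl

/-- The same isomorphism for `O^×(A)` in [FrdI] Def. 1.2 (ii) form (`PreFrobenioid.unitsSubgroup`),
without `hF`. [cite: MochizukiEtTh2009, Thm 3.7 p.79] -/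
theorem nonempty_unitsSubgroup_mulEquiv_ker_of_isDivisorial
    (hΦ : ∀ A : D, IsDivisorial (C₀.divisorMonoid.obj (op A))) (X : C₀.category) :
    Nonempty (PreFrobenioid.unitsSubgroup C₀.toElem X ≃*
      ((T.divΛ (C₀.baseOp (op X.base))).comp
        (Units.coeHom (T.BΛ.obj (C₀.baseOp (op X.base))))).ker) := by
  obtain ⟨e⟩ := C₀.nonempty_units_mulEquiv_ker_of_isDivisorial hΦ X
  exact ⟨(MulEquiv.subgroupCongr (C₀.unitsSubgroup_toElem_eq_units X)).trans e⟩

/-- **(L06) Thm. 3.7 (i), "`C` is of unit-profinite type" (the case `Λ = ℤ`), without `hF`**: for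
divisorial `Φ(A_D)` it holds as soon as each kernel `Ker(B₀^Λ(Y_A)^× → (Φ₀^ℝ)^gp(Y_A))` admits a tfg
profinite topology (print: "By Proposition 3.4, (ii)", `Ker ≅ O_L^×`).
[cite: MochizukiEtTh2009, Thm 3.7 p.79] -/
theorem isOfUnitProfiniteType_of_isDivisorial_of_ker
    (hΦ : ∀ A : D, IsDivisorial (C₀.divisorMonoid.obj (op A)))
    (hker : ∀ A : Dᵒᵖ, AdmitsTfgProfiniteTopology
      ((T.divΛ (C₀.baseOp A)).comp (Units.coeHom (T.BΛ.obj (C₀.baseOp A)))).ker) :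
    PreFrobenioid.IsOfUnitProfiniteType C₀.toElem := fun X => by
  obtain ⟨e⟩ := C₀.nonempty_unitsSubgroup_mulEquiv_ker_of_isDivisorial hΦ X
  exact AdmitsTfgProfiniteTopology.of_mulEquiv e.symm (hker _)

/-- **Thm. 3.7 (iv) without `hF`**, the case `Λ = ℤ` through the kernel datum of (L06).
[cite: MochizukiEtTh2009, Thm 3.7 p.80] -/
theorem thm37_iv_of_isDivisorial_of_ker
    (hΦ : ∀ A : D, IsDivisorial (C₀.divisorMonoid.obj (op A)))
    (hker : ∀ A : Dᵒᵖ, AdmitsTfgProfiniteTopology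
      ((T.divΛ (C₀.baseOp A)).comp (Units.coeHom (T.BΛ.obj (C₀.baseOp A)))).ker) : C₀.Thm37_iv :=
  C₀.thm37_iv_of_sharp_of_isOfUnitProfiniteType (fun A => (hΦ A).isSharp)
    (C₀.isOfUnitProfiniteType_of_isDivisorial_of_ker hΦ hker)

end General

/-! ## At the canonical [FrdI] vocabulary `treeCatVocab`: `Φ` divisorial on `D` — no residual datum -/

section TreeVocab

variable {IsRational IsStrictlyRational : (Dᵒᵖ ⥤ CommMonCat.{w}) → Prop}
  (C₀ : TemperedFrobenioid T D (treeCatVocab D IsRational IsStrictlyRational))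

/-- **Thm. 3.7 (i), "unit-trivial type" at the canonical vocabulary**, from the injectivity of
`B₀^Λ → (Φ₀^ℝ)^gp` ALONE (no `hBmon`). [cite: MochizukiEtTh2009, Thm 3.7 p.79] -/
theorem thm37_i_unitTrivial_treeCatVocab_of_divΛ_injective
    (hinj : ∀ A : Dᵒᵖ, Function.Injective (T.divΛ (C₀.baseOp A))) :
    PreFrobenioid.IsOfType (PreFrobenioid.IsUnitTrivial C₀.toElem) :=
  C₀.thm37_i_unitTrivial_of_isDivisorial C₀.isDivisorial_divisorMonoid hinj

/-- **Thm. 3.7 (iv) at the canonical vocabulary, the case `Λ = ℝ`** (injective `B₀^Λ → (Φ₀^ℝ)^gp`), no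
residual datum. [cite: MochizukiEtTh2009, Thm 3.7 p.80] -/
theorem thm37_iv_treeCatVocab_of_divΛ_injective
    (hinj : ∀ A : Dᵒᵖ, Function.Injective (T.divΛ (C₀.baseOp A))) : C₀.Thm37_iv :=
  C₀.thm37_iv_of_isDivisorial_of_divΛ_injective C₀.isDivisorial_divisorMonoid hinj

/-- **Thm. 3.7 (iv) at the canonical vocabulary, the case `Λ = ℤ`** from "unit-profinite type" ALONE.
[cite: MochizukiEtTh2009, Thm 3.7 p.80] -/
theorem thm37_iv_treeCatVocab_of_isOfUnitProfiniteType
    (hprof : PreFrobenioid.IsOfUnitProfiniteType C₀.toElem) : C₀.Thm37_iv :=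
  C₀.thm37_iv_of_sharp_of_isOfUnitProfiniteType (fun A => (C₀.isDivisorial_divisorMonoid A).isSharp)
    hprof

/-- **Thm. 3.7 (i), "unit-profinite type" at the canonical vocabulary** from the kernel datum of (L06)
ALONE. [cite: MochizukiEtTh2009, Thm 3.7 p.79] -/
theorem isOfUnitProfiniteType_treeCatVocab_of_ker
    (hker : ∀ A : Dᵒᵖ, AdmitsTfgProfiniteTopology
      ((T.divΛ (C₀.baseOp A)).comp (Units.coeHom (T.BΛ.obj (C₀.baseOp A)))).ker) :
    PreFrobenioid.IsOfUnitProfiniteType C₀.toElem :=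
  C₀.isOfUnitProfiniteType_of_isDivisorial_of_ker C₀.isDivisorial_divisorMonoid hker

/-- **Thm. 3.7 (iv) at the canonical vocabulary, the case `Λ = ℤ`** from the kernel datum of (L06) ALONE.
[cite: MochizukiEtTh2009, Thm 3.7 p.80] -/
theorem thm37_iv_treeCatVocab_of_ker
    (hker : ∀ A : Dᵒᵖ, AdmitsTfgProfiniteTopology
      ((T.divΛ (C₀.baseOp A)).comp (Units.coeHom (T.BΛ.obj (C₀.baseOp A)))).ker) : C₀.Thm37_iv :=
  C₀.thm37_iv_of_isDivisorial_of_ker C₀.isDivisorial_divisorMonoid hker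

end TreeVocab

/-! ## The constructed data of monoid type `ℝ` (`RealifiedDivisorMonoids.ofRlfR`) -/

section OfRlfR

variable (dm : DivisorMonoids.{u₀, v₀, w} D₀) (hpf : ∀ Y : D₀ᵒᵖ, IsPerfFactorial (dm.Φ₀.obj Y))

section AnyVocab

variable {VD : FrdICatStub.{u, v, w} D}
  (C₀ : TemperedFrobenioid (RealifiedDivisorMonoids.ofRlfR dm hpf) D VD)

/-- **Thm. 3.7 (i), "unit-trivial type", for every tempered Frobenioid of monoid type `ℝ` over the
constructed data `ofRlfR`**, for divisorial `Φ(A_D)` (no `hF`). [cite: MochizukiEtTh2009, Thm 3.7 p.79] -/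
theorem thm37_i_unitTrivial_ofRlfR_of_isDivisorial
    (hΦ : ∀ A : D, IsDivisorial (C₀.divisorMonoid.obj (op A))) :
    PreFrobenioid.IsOfType (PreFrobenioid.IsUnitTrivial C₀.toElem) :=
  C₀.thm37_i_unitTrivial_of_isDivisorial hΦ fun A =>
    RealifiedDivisorMonoids.ofRlfR_divΛ_injective dm hpf (C₀.baseOp A)

/-- **Thm. 3.7 (iv) for every tempered Frobenioid of monoid type `ℝ` over `ofRlfR` data**, for divisorial
`Φ(A_D)` (no `hF`). [cite: MochizukiEtTh2009, Thm 3.7 p.80] -/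
theorem thm37_iv_ofRlfR_of_isDivisorial
    (hΦ : ∀ A : D, IsDivisorial (C₀.divisorMonoid.obj (op A))) : C₀.Thm37_iv :=
  C₀.thm37_iv_of_isDivisorial_of_divΛ_injective hΦ fun A =>
    RealifiedDivisorMonoids.ofRlfR_divΛ_injective dm hpf (C₀.baseOp A)

end AnyVocab

section TreeVocab

variable {IsRational IsStrictlyRational : (Dᵒᵖ ⥤ CommMonCat.{w}) → Prop}
  (C₀ : TemperedFrobenioid (RealifiedDivisorMonoids.ofRlfR dm hpf) D
    (treeCatVocab D IsRational IsStrictlyRational))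

/-- **Thm. 3.7 (i), "unit-trivial type" for monoid type `ℝ` over `ofRlfR` data at the canonical [FrdI]
vocabulary — UNCONDITIONAL** (supersedes `thm37_i_unitTrivial_ofRlfR_treeCatVocab (hBmon)`).
[cite: MochizukiEtTh2009, Thm 3.7 p.79] -/
theorem thm37_i_unitTrivial_ofRlfR_treeCatVocab_holds
    (C : TemperedFrobenioid (RealifiedDivisorMonoids.ofRlfR dm hpf) D
      (treeCatVocab D IsRational IsStrictlyRational)) :
    PreFrobenioid.IsOfType (PreFrobenioid.IsUnitTrivial C.toElem) :=
  C.thm37_i_unitTrivial_ofRlfR_of_isDivisorial dm hpf C.isDivisorial_divisorMonoid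

/-- The two UNIT conjuncts of the typed `Thm37_i F` for such data and ANY facade `F` (the `Λ = ℤ` conjunct
is vacuous: the monoid type is `ℝ`) — UNCONDITIONAL. [cite: MochizukiEtTh2009, Thm 3.7 p.79] -/
theorem thm37_i_unitConjuncts_ofRlfR_treeCatVocab_holds (F : FrobenioidFacade.{u, v, w} D) :
    (C₀.monoidType = MonoidType.Z → F.IsOfUnitProfiniteType C₀.toElem) ∧
      (C₀.monoidType = MonoidType.R →
        PreFrobenioid.IsOfType (PreFrobenioid.IsUnitTrivial C₀.toElem)) :=
  ⟨fun h => absurd ((C₀.monoidType_ofRlfR dm hpf).symm.trans h) (by decide),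
    fun _ => thm37_i_unitTrivial_ofRlfR_treeCatVocab_holds dm hpf C₀⟩

/-- **Thm. 3.7 (iv) "`D` slim ⟹ `C` slim" for monoid type `ℝ` over `ofRlfR` data at the canonical [FrdI]
vocabulary — UNCONDITIONAL** (the named `Prop` `Thm37_iv` with NO hypothesis; supersedes
`thm37_iv_ofRlfR_treeCatVocab (hBmon)`). [cite: MochizukiEtTh2009, Thm 3.7 p.80] -/
theorem thm37_iv_ofRlfR_treeCatVocab_holds
    (C : TemperedFrobenioid (RealifiedDivisorMonoids.ofRlfR dm hpf) D
      (treeCatVocab D IsRational IsStrictlyRational)) :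
    Literature.AnabelianGeometry.EtaleTheta.TemperedFrobenioid.Thm37_iv C :=
  C.thm37_iv_ofRlfR_of_isDivisorial dm hpf C.isDivisorial_divisorMonoid

end TreeVocab

end OfRlfR

end TemperedFrobenioid

end Literature.AnabelianGeometry.EtaleTheta
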